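import Literature.NumberTheory.EllipticCurves.TateModuleOpenImageNonCMProofs
import Literature.NumberTheory.EllipticCurves.Kato2004.Condition1252QuadraticTwistProofs
import Literature.NumberTheory.EllipticCurves.GlobalMinimalModelProofs
import Literature.NumberTheory.EllipticCurves.ComplexMultiplicationHasCMProofs
import HarnessLib

/-!
# Serre's open image theorem for non-CM elliptic curves over `ℚ`, framed form: the image of
# `Γ_ℚ →ₜ* GL₂(ℚ_p)` (any model, any `ℚ_p`-basis of `V_pE`, every `p`) is OPEN (proofs file)

Topic `NumberTheory/EllipticCurves`.  Theorems only (no definition, no named fact, no `sorry`).  Cell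
`bsd-potss`, seat `bsd-potss-k8q-c2x` g5.  HONEST FRAMING: classical Galois theory of elliptic curves,
proved in the kernel from the tree's theorems; BSD is not advanced by this file beyond giving
consumers of Kato's Euler-system bound the open-image input in its standard phrasing.

The integral matrix form `WeierstrassCurve.exists_congruenceSubgroup_le_of_not_hasCM` (sibling file
`TateModuleOpenImageNonCMProofs`: for a globally minimal non-CM `E/ℚ` the image of
`Γ_ℚ → GL₂(ℤ_p)` contains `Γ(pˢ)`) is repackaged in the currency of the tree's named fact
`momose_isOpen_range_galoisRep` (open image for rational non-CM newforms): for EVERY elliptic curve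
`E/ℚ` WITHOUT complex multiplication (any Weierstrass model), every prime `p`, every continuity witness
`h` and every `ℚ_p`-basis `b` of `V_pE = ℚ_p ⊗ T_pE`, the framed representation
`(rationalTateGaloisRepOf (geomPoints W) p h).frame b : Γ_ℚ →ₜ* GL₂(ℚ_p)` has OPEN image
(`WeierstrassCurve.isOpen_range_frame_rationalTateGaloisRep_of_not_hasCM`).  Serre, *Abelian ℓ-adic
representations* (1968), IV-11, Théorème: "If `E` has no complex multiplication, then `𝔤_ℓ = End(V_ℓ)`,
i.e. `Im(ρ_ℓ)` is open in `Aut(T_ℓ)`" — for all `ℓ` (1972, §4.4 Thm. 3 removes the 1968 restriction).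

Steps: (1) in the basis `1 ⊗ b_T` induced by a `ℤ_p`-basis of `T_pE` the frame's matrices are the
integral ones (Mathlib `LinearMap.toMatrix_baseChange`), so the image contains `ι(Γ(pˢ))`, a
neighbourhood of `1` (`OpenImage.isOpen_of_map_congruenceSubgroup_le`); (2) two frames are conjugate
(`ContinuousRep.exists_frame_eq_conj`) and conjugation is a homeomorphism of `GL₂(ℚ_p)`; (3) any model
`E` has a global minimal model `C • E` (`hasGlobalMinimalModel_rat_holds`), still without CM
(`HasCM.of_variableChange_baseChange`), with a `Γ_ℚ`-equivariant `V_pE ≃ V_p(C • E)`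
(`VariableChange.pointEquivBaseChange`, `exists_tateModule_linearEquiv_of_addEquiv`, base change),
along which frames correspond.

References: [SerreAbelianLadic1968] Ch. IV §2.2 Théorème (IV-11); [Serre1972] §4.4 Thm. 3;
[SilvermanAEC2009] VIII.8 Cor. 8.3.
-/

noncomputable section

open scoped MatrixGroups Classical
open Field Filter Topology
open Literature.NumberTheory.GaloisRepresentations Literature.NumberTheory.EllipticCurves
open Literature.NumberTheory.EllipticCurves.ModularForms.OpenImage Literature.GroupTheory.Index

namespace WeierstrassCurve

variable {p : ℕ} [Fact p.Prime]

/-- **Matrices of `V_pE` framed in `1 ⊗ b_T` are the integral matrices of `T_pE` in `b_T`** (Mathlib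
`LinearMap.toMatrix_baseChange`; Silverman III.7 Remark 7.2: "`G → GL₂(ℤ_ℓ)`, and then the natural
inclusion `ℤ_ℓ ⊂ ℚ_ℓ` gives `G → GL₂(ℚ_ℓ)`"). [cite: SilvermanAEC2009, Remark III.7.2 (p. 88)] -/
theorem coe_frame_tensorBasis_apply {K : Type} [Field K] (W : WeierstrassCurve K)
    (h : Continuous fun x : absoluteGaloisGroup K × RationalTateModule (geomPoints W) p ↦
      rationalTateRepresentation (absoluteGaloisGroup K) (geomPoints W) p x.1 x.2)
    (bT : Module.Basis (Fin 2) ℤ_[p] (W.tateModule p)) (σ : absoluteGaloisGroup K) :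
    (((rationalTateGaloisRepOf (geomPoints W) p h).frame
        (Algebra.TensorProduct.basis ℚ_[p] bT : Module.Basis (Fin 2) ℚ_[p] (W.rationalTateModule p)) σ :
          GL (Fin 2) ℚ_[p]) : Matrix (Fin 2) (Fin 2) ℚ_[p]) =
      (LinearMap.toMatrix bT bT (W.galoisRepTate p σ)).map ((↑) : ℤ_[p] → ℚ_[p]) := by
  rw [ContinuousRep.coe_frame_apply]
  change LinearMap.toMatrix _ _ (W.rationalGaloisRepTate p σ) = _
  rw [rationalGaloisRepTate_eq_baseChange]
  exact LinearMap.toMatrix_baseChange ℚ_[p] (W.galoisRepTate p σ) bT bT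

/-- **Conjugation preserves openness of the image** of a framed representation (conjugation by
`P ∈ GL_n(A)` is a homeomorphism of `GL_n(A)`). [folklore] -/
private theorem isOpen_range_conj {G : Type*} [Group G] [TopologicalSpace G] {A : Type*} [CommRing A]
    [TopologicalSpace A] [IsTopologicalRing A] {n : ℕ} (P : GL (Fin n) A) (ρ : FramedRep G A n)
    (hρ : IsOpen (Set.range ⇑ρ)) : IsOpen (Set.range ⇑(FramedRep.conj P ρ)) := by
  have hset : Set.range ⇑(FramedRep.conj P ρ) =
      ((Homeomorph.mulLeft P).trans (Homeomorph.mulRight P⁻¹)) '' Set.range ⇑ρ := by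
    ext x
    simp only [Set.mem_range, FramedRep.conj_apply, Set.mem_image, Homeomorph.trans_apply,
      Homeomorph.coe_mulLeft, Homeomorph.coe_mulRight]
    constructor
    · rintro ⟨g, rfl⟩
      exact ⟨ρ g, ⟨g, rfl⟩, rfl⟩
    · rintro ⟨y, ⟨g, rfl⟩, rfl⟩
      exact ⟨g, rfl⟩
  rw [hset]
  exact ((Homeomorph.mulLeft P).trans (Homeomorph.mulRight P⁻¹)).isOpenMap _ hρ

/-- **Step 1 — open image in the basis `1 ⊗ b_T`, globally minimal model.**  For a globally minimal
non-CM `E/ℚ`, a prime `p`, a `ℤ_p`-basis `b_T` of `T_pE` and any continuity witness `h`, the image of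
`V_pE` framed in `1 ⊗ b_T` is open in `GL₂(ℚ_p)`: it contains `ι(Γ(pˢ))`
(`exists_congruenceSubgroup_le_of_not_hasCM`), a neighbourhood of `1`.
[cite: SerreAbelianLadic1968, Ch. IV §2.2 Théorème (IV-11)] -/
theorem isOpen_range_frame_tensorBasis_of_not_hasCM (W : WeierstrassCurve ℚ) [W.IsElliptic]
    [W.IsGloballyMinimal] (hW : ¬ W.HasCM) (p : ℕ) [Fact p.Prime]
    (h : Continuous fun x : absoluteGaloisGroup ℚ × RationalTateModule (geomPoints W) p ↦
      rationalTateRepresentation (absoluteGaloisGroup ℚ) (geomPoints W) p x.1 x.2)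
    (bT : Module.Basis (Fin 2) ℤ_[p] (W.tateModule p)) :
    IsOpen (Set.range ⇑((rationalTateGaloisRepOf (geomPoints W) p h).frame
      (Algebra.TensorProduct.basis ℚ_[p] bT : Module.Basis (Fin 2) ℚ_[p] (W.rationalTateModule p)))) := by
  set ρ := (rationalTateGaloisRepOf (geomPoints W) p h).frame
    (Algebra.TensorProduct.basis ℚ_[p] bT : Module.Basis (Fin 2) ℚ_[p] (W.rationalTateModule p))
    with hρdef
  obtain ⟨s, hs2, hall⟩ := W.exists_congruenceSubgroup_le_of_not_hasCM hW p bT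
  have hrange : ((ρ.toMonoidHom.range : Subgroup (GL (Fin 2) ℚ_[p])) : Set (GL (Fin 2) ℚ_[p])) =
      Set.range ⇑ρ := by
    rw [MonoidHom.coe_range]
    rfl
  rw [← hrange]
  refine isOpen_of_map_congruenceSubgroup_le (ℓ := p) (m := s) (by omega) ?_
  rintro _ ⟨M, hM, rfl⟩
  obtain ⟨σ, hσ⟩ := hall M hM
  refine ⟨σ, ?_⟩
  change ρ σ = _
  apply Units.ext
  rw [hρdef, coe_frame_tensorBasis_apply, hσ, coe_map_coeRingHom]

/-- **Step 2 — any `ℚ_p`-basis, globally minimal model**: frames in two bases are conjugate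
(`ContinuousRep.exists_frame_eq_conj`) and conjugation is a homeomorphism.
[cite: SerreAbelianLadic1968, Ch. IV §2.2 Théorème (IV-11)] -/
theorem isOpen_range_frame_of_not_hasCM_of_isGloballyMinimal (W : WeierstrassCurve ℚ) [W.IsElliptic]
    [W.IsGloballyMinimal] (hW : ¬ W.HasCM) (p : ℕ) [Fact p.Prime]
    (h : Continuous fun x : absoluteGaloisGroup ℚ × RationalTateModule (geomPoints W) p ↦
      rationalTateRepresentation (absoluteGaloisGroup ℚ) (geomPoints W) p x.1 x.2)
    (b : Module.Basis (Fin 2) ℚ_[p] (W.rationalTateModule p)) :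
    IsOpen (Set.range ⇑((rationalTateGaloisRepOf (geomPoints W) p h).frame b)) := by
  have hp0 : (p : ℚ) ≠ 0 := Nat.cast_ne_zero.mpr (Fact.out : p.Prime).ne_zero
  haveI : Module.Free ℤ_[p] (W.tateModule p) := module_free_tateModule_holds W p
  haveI : Module.Finite ℤ_[p] (W.tateModule p) := module_finite_tateModule_holds W p
  let bT : Module.Basis (Fin 2) ℤ_[p] (W.tateModule p) :=
    Module.finBasisOfFinrankEq ℤ_[p] (W.tateModule p) (finrank_tateModule_eq_two_holds W p hp0)
  obtain ⟨P, hP⟩ := (rationalTateGaloisRepOf (geomPoints W) p h).exists_frame_eq_conj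
    (Algebra.TensorProduct.basis ℚ_[p] bT : Module.Basis (Fin 2) ℚ_[p] (W.rationalTateModule p)) b
  rw [hP]
  exact isOpen_range_conj P _ (W.isOpen_range_frame_tensorBasis_of_not_hasCM hW p h bT)

/-- **Serre's open image theorem for non-CM elliptic curves over `ℚ`, framed form (Serre 1968,
IV-11; 1972, §4.4 Thm. 3).**  For EVERY elliptic curve `E = W/ℚ` WITHOUT (geometric) complex
multiplication — any Weierstrass model — every prime `p`, every continuity witness `h` and every
`ℚ_p`-basis `b` of `V_pE`, the image of the framed `p`-adic representation
`(rationalTateGaloisRepOf (geomPoints W) p h).frame b : Gal(ℚ̄/ℚ) →ₜ* GL₂(ℚ_p)` is OPEN.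
Reduction to a global minimal model `C • E` (`hasGlobalMinimalModel_rat_holds`; no CM preserved) along
the `Γ_ℚ`-equivariant `V_pE ≃ V_p(C • E)`, under which frames correspond, then
`isOpen_range_frame_of_not_hasCM_of_isGloballyMinimal`.
[cite: SerreAbelianLadic1968, Ch. IV §2.2 Théorème (IV-11)] [cite: Serre1972, §4.4 Thm. 3]
[cite: SilvermanAEC2009, VIII.8 Cor. 8.3] -/
theorem isOpen_range_frame_rationalTateGaloisRep_of_not_hasCM (W : WeierstrassCurve ℚ) [W.IsElliptic]
    (hW : ¬ W.HasCM) (p : ℕ) [Fact p.Prime]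
    (h : Continuous fun x : absoluteGaloisGroup ℚ × RationalTateModule (geomPoints W) p ↦
      rationalTateRepresentation (absoluteGaloisGroup ℚ) (geomPoints W) p x.1 x.2)
    (b : Module.Basis (Fin 2) ℚ_[p] (W.rationalTateModule p)) :
    IsOpen (Set.range ⇑((rationalTateGaloisRepOf (geomPoints W) p h).frame b)) := by
  -- a global minimal model `W' = C • W`, still without complex multiplication
  obtain ⟨C, hC⟩ := hasGlobalMinimalModel_rat_holds W
  haveI := hC
  have hCM' : ¬ (C • W).HasCM := fun h' ↦ hW
    (HasCM.of_variableChange_baseChange (W₁ := W) (W₂ := C • W)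
      (C.map (algebraMap ℚ (AlgebraicClosure ℚ))) (map_variableChange W C _) h')
  -- the `Γ_ℚ`-equivariant `T_pW ≃ T_p(C • W)` and its base change `LV : V_pW ≃ V_p(C • W)`
  let e : W.geomPoints ≃+ (C • W).geomPoints := VariableChange.pointEquivBaseChange W C (AlgebraicClosure ℚ)
  have he : ∀ τ ∈ (Set.univ : Set (absoluteGaloisGroup ℚ)), ∀ P, e (τ • P) = τ • e P :=
    fun τ _ P ↦ VariableChange.pointEquivBaseChange_map_algEquiv W C
      (absoluteGaloisGroup.toAlgEquiv ℚ τ) P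
  obtain ⟨L, hL⟩ := exists_tateModule_linearEquiv_of_addEquiv _ _ p _ e he
  let LV : W.rationalTateModule p ≃ₗ[ℚ_[p]] (C • W).rationalTateModule p :=
    L.baseChange ℤ_[p] ℚ_[p] (W.tateModule p) ((C • W).tateModule p)
  have hLV : ∀ σ, (LV : W.rationalTateModule p →ₗ[ℚ_[p]] (C • W).rationalTateModule p).comp
      (W.rationalGaloisRepTate p σ) =
        ((C • W).rationalGaloisRepTate p σ).comp
          (LV : W.rationalTateModule p →ₗ[ℚ_[p]] (C • W).rationalTateModule p) := by
    intro σ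
    have hT : (L : W.tateModule p →ₗ[ℤ_[p]] (C • W).tateModule p).comp (W.galoisRepTate p σ) =
        ((C • W).galoisRepTate p σ).comp (L : W.tateModule p →ₗ[ℤ_[p]] (C • W).tateModule p) := by
      refine LinearMap.ext fun a => ?_
      exact hL σ (Set.mem_univ σ) a
    change ((L : W.tateModule p →ₗ[ℤ_[p]] (C • W).tateModule p).baseChange ℚ_[p]).comp
        ((W.galoisRepTate p σ).baseChange ℚ_[p]) =
      (((C • W).galoisRepTate p σ).baseChange ℚ_[p]).comp
        ((L : W.tateModule p →ₗ[ℤ_[p]] (C • W).tateModule p).baseChange ℚ_[p])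
    rw [← LinearMap.baseChange_comp, ← LinearMap.baseChange_comp, hT]
  -- the frame of `W` in `b` IS the frame of `C • W` in `b.map LV`
  set ρ := (rationalTateGaloisRepOf (geomPoints W) p h).frame b with hρdef
  set ρ' := (rationalTateGaloisRepOf (geomPoints (C • W)) p
    ((C • W).continuous_rationalGaloisRepTate_holds p)).frame (b.map LV) with hρ'def
  have heq : ∀ σ, ρ σ = ρ' σ := by
    intro σ
    apply Units.ext
    rw [hρdef, hρ'def, ContinuousRep.coe_frame_apply, ContinuousRep.coe_frame_apply]
    change LinearMap.toMatrix b b (W.rationalGaloisRepTate p σ) =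
      LinearMap.toMatrix (b.map LV) (b.map LV) ((C • W).rationalGaloisRepTate p σ)
    ext i j
    rw [LinearMap.toMatrix_apply, LinearMap.toMatrix_apply, Module.Basis.map_apply,
      Module.Basis.map_repr, LinearEquiv.trans_apply]
    have hcomp := congrArg (fun f : W.rationalTateModule p →ₗ[ℚ_[p]] (C • W).rationalTateModule p =>
      f (b j)) (hLV σ)
    simp only [LinearMap.comp_apply, LinearEquiv.coe_coe] at hcomp
    rw [← hcomp, LinearEquiv.symm_apply_apply]
  have hrange : Set.range ⇑ρ = Set.range ⇑ρ' := by
    ext x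
    constructor
    · rintro ⟨σ, rfl⟩; exact ⟨σ, (heq σ).symm⟩
    · rintro ⟨σ, rfl⟩; exact ⟨σ, heq σ⟩
  rw [hrange]
  exact (C • W).isOpen_range_frame_of_not_hasCM_of_isGloballyMinimal hCM' p _ (b.map LV)

end WeierstrassCurve

end
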